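import Summits.BirchSwinnertonDyer.Rank1Residual.O5.MultiplicityAtNine
import Literature.NumberTheory.EllipticCurves.BSDHeegnerPoints
import HarnessLib

/-!
# Jochnowitz congruences at conductor exponent two (`9 ∥ N`, `p = 3`) — conjecture E-O5-JOCH3,
# the Brandt-side multiplicity `μ_B` and the census record schema (cell `b2b-bsdres`, lane
# CLASS-CLOSURE, team o5; content = planner o5-r2 GEN 10 (non-Iwasawa side), placement + dedup =
# cc-typer-5 GEN 14, A-O5-J0) — TYPED, NOTHING ASSERTED

HONEST FRAMING (cell `b2b-bsdres`, verbatim in every file): the goal of the cell is to DELETE the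
COMBINATION-SHAPED residual classes of the Birch–Swinnerton-Dyer formula for ALL analytic-rank `≤ 1`
elliptic curves over `ℚ`, assembled STRICTLY from published theorems, so that the rank-`≤ 1` remainder
becomes exactly the CONSTRUCTION-SHAPED classes, which are TYPED (missing-input `Prop`s), NOT attempted.
This is not "finishing BSD". Lane CLASS-CLOSURE §3.5 O5: research routes; census output is EVIDENCE /
conjecture items, never a Literature fact; no `_holds`; nothing is booked; no mark of `RESIDUAL-MAP.md`
moves.

WHY THIS FILE (team file `HOME/cells/o5o6/TARGETS.md` §O5, o5-r2 Z-LEDGER item (Z3) "Bertolini–Darmon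
reciprocity / Jochnowitz congruence at `p = 3 ∣ N`: printed only for `p ∤ N`"). Bertolini–Darmon, *Euler
systems and Jochnowitz congruences*, Amer. J. Math. 121 (1999) [held: paper:doi-10-1353-ajm-1999-0010]
prove, for `p ∤ 2N·deg(π_E)`, `ρ̄_{E,p}` irreducible and `q` a Kolyvagin prime (Thm. 1.3, p. 5/24; Thm.
6.1; multiplicity one Thm. 2.3, p. 10; Gross points and `L(g/K,1)^alg`, Def. 4.2, p. 21; Gross's formula
(15), p. 22): the Heegner point `y_K` is non-zero in `E(K_q)/pE(K_q)` iff `L(g/K, 1) ≢ 0 (mod m_g)` for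
every `q`-new form `g` on `J₀(Nq)` congruent to `E`, equivalently iff the Gross-points vector `ψ_K` of the
definite quaternion algebra ramified at `{q, ∞}` is non-zero in `M/𝔪M`. At `p = 3`, `9 ∥ N` (the (t′)
cell) nothing is printed: `p ∣ N`, Thm. 2.3 is unavailable, and the `J₀(N)` multiplicity is `2` or `3`
(this directory's `MultiplicityAtNine`). Note also that BD-ADMISSIBLE primes (`p ∤ q² − 1`) do not exist
at `p = 3`; KOLYVAGIN primes (`Frob_q` = complex conjugation in `K(E[3])/ℚ`: `q ≡ 2 (mod 3)`, `q` inert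
in `K`, `a_q(E) ≡ 0 (mod 3)`) do, and level-raise for both signs.

INSTRUMENT (o5-r2 GEN 10, `HOME/b2b-bsdres-o5-r2/gen10/joch3/o5r2g10_brandt3.py`, pre-registration
`JOCH3-PREREG.md` sha16 b9651ddc6213c9ed, census kit j149039): the EXACT Brandt module of
`B = (−3, −q)_ℚ` at Eichler level `N` (including the factor `9`), mass-certified class set, Hecke
operators `T_ℓ`, the involution `W_q`, the mod-`3` eigenspaces `V^s` (`s = ±1` the `W_q`-sign,
calibrated `= U_q`-sign on rational `q`-new forms), the ORIENTED Gross-points vector `ψ_K` (orientations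
at every `ℓ^e ∥ N` and at `q`, transported through the ideal classes; `Σ ψ_K = h_K`, `W_q ψ_K⁺ = ψ_K⁻`
asserted per row), the bit `r^s = [ψ_K ∉ 𝔪^s M̃]`, and on the curve side the Heegner currency
`k_E = ½ ord₃(Ш_an(E) Ш_an(E^D)) + ord₃ ∏_{ℓ∣N} c_ℓ(E)` (Gross–Zagier + BSD prediction of
`ord₃ [E(K) ⊗ ℤ₃ : ℤ₃ y_K]`, EVIDENCE — analytic Ш from Cremona's `allbsd`) and the local bit "the
Mordell–Weil generator of the rank-one member of `{E, E^D}` is not divisible by `3` in `E(𝔽_q)`" (Cremona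
`allgens`); engine of record sha16 abd8d221fef5f5c7 (`JOCH3-PREREG-ADDENDUM-1.md`), stability arm S2 = kit j149268 (12
Hecke primes instead of 6). CENSUS-1 (kit j149039, 70/70 rows, record `gen10/joch3/JOCH3-CENSUS-1.md`): CALIBRATION = BD99's
theorem regime (`3 ∤ N`, `3 ∤ deg π_E`, 33 rows `11 ≤ N ≤ 118`): `dim V^± = 1` 33/33 (multiplicity one), `r^{s_E} = LHS_E`
33/33 with 6 NEGATIVE instances, `r^{−s_E} = 0` 33/33 — the printed theorem and its sign convention `s_E = (−1)^{r_an(E/ℚ)+1}`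
reproduced exactly; the 7 rows with `3 ∣ deg π_E` fit the main law 7/7 with one companion-carried opposite-sign bit (N = 116);
the `W`-sign of the exact eigenvector of every rational `q`-new curve `G` equals `a_q(G)` (87/87) and `φ_G · ψ_K = 0` exactly
when `r_an(G/K) > 0` (21/21). O5 (the 30 of the 59 (t′) isogeny classes with `9 ∥ N ≤ 610` that admit a testable Heegner datum —
`K = ℚ(√D)`, `|D| ≤ 150`, with `E^D` inside Cremona's range and `r_an(E/K) = 1`, and a Kolyvagin `q` with Brandt class number `h ≤ 1100`;
the other 29 are OUT OF REACH of the instrument as configured (24 without such `K`, 5 — 468a1/b1/c1, 549a1/b1 — without such `q`), listed in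
the census record, untested, not counterexamples; one `(K, q)` each): the MAIN-SIGN law
`r^{s_E} = LHS_E` holds 30/30 with 10 NEGATIVE instances; the opposite-sign clause fails on 12/30 rows, on 11 of which a
RATIONAL mod-3 companion of opposite rank parity with a locally 3-indivisible Heegner point carries the direction, the 12th
(477a1) having no rational companion (vector law J-c: 139/140 bits over all 70 rows); `μ_B ≥ 2` on every O5 row.

Contents (definitions; no named fact; nothing asserted): §1 the INTERFACES `BrandtJochnowitzData`
(D-O5-J1: the mod-`3` Brandt eigenspace dimension `μ_B` and the predicate "`ψ_K` is seen") and
`HeegnerLocalData` (D-O5-J2: "`y_K ≠ 0` in `E(K_𝔮)/3`"); the concrete predicate `IsKolyvaginPrimeAtThree`;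
§2 BD99's theorem as a HYPOTHESIS SHAPE over the interfaces (`JochnowitzBD99Shape`, never a fact), the
conjecture E-O5-JOCH3 = `JochnowitzAtNine` (the MAIN-SIGN law: at the BD sign `s_E`, `ψ_K` is seen iff `y_K` is
`3`-indivisible locally at `q`), the tombstone `JochnowitzAtNineNaive` (the naive two-sign transplant, pre-registered
and refuted by census-1's opposite-sign rows), the companion-visibility law `CompanionVisibilityAtNine` (P2 classes
(i)/(iii), rational-companion direction) and the Brandt multiplicity statement `BrandtMultAtNine` (level raising at a
Kolyvagin prime in both signs; EVIDENCE); §3 the census record schema `JochRow`; the 70 rows of census-1 (`o5Rows`, `calRows`), the 22 rows of arm S3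
(`s3Rows`) and the kernel-checked TABLE CHECKS (`decide`: every row fits the main-sign law — `o5Rows_fitsMain`,
`calRows_fitsMain`, `s3Rows_fitsMain`; the naive law fails on the O5 rows — `o5Rows_naive_fails`, 12 leaking rows — and
holds on BD99's clean calibration rows) live in the sibling RECORDS file `O5/JochnowitzAtThreeRecords.lean`; §4 two
PROVED kernel edges (cc-typer-5): `CompanionVisibilityAtNine` with the carrier `E′ = E` IS the (←) half of
`JochnowitzAtNine`, so given it T-O5-J reduces to its E-only (→) half.
Census test that falsifies E-O5-JOCH3: ONE O5 row of kit j149039 (or its successors) with complete curve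
data in class (ii) "invisible Heegner point" (`LHS_E = 1`, `r^{s_E} = 0`) or with `r^{−s_E} = 1` not
explained by a companion. References: [BertoliniDarmon1999] Thm. 1.3, 2.3, 6.1, Def. 4.2, (15);
[Gross1987] B. Gross, *Heights and the special values of L-series*, CMS Conf. Proc. 7; [GrossZagier1986];
[Ribet1990] level raising; [AgasheRibetStein2012] Prop. 2.3 (multiplicity one fails at `99a1`, `p = 3`);
Cremona's `ecdata` (allcurves/allbsd/allgens/allisog).

TYPER NOTES (cc-typer-5 GEN 14, A-O5-J0 of o5-r2 GEN 10, INBOX 2026-08-22T04:47Z; decisions of record). NAMES and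
STATEMENTS VERBATIM from the planner's sketch `b2b-bsdres-o5-r2/gen10/lean/JochnowitzAtThree.lean` (sha16
`0b64983cb0b398ad`, farm rc 0 as delivered and re-checked by o5-r2 GEN 11); the only edits are the records split (400-line
lint; the `MultiplicityAtNine` / `…Records` precedent) and §4.  DEDUP: no name of this file exists elsewhere in the tree;
`IsKolyvaginPrimeAtThree W D q` is the CENSUS-DECIDABLE form at `p = 3` of Gross's Kolyvagin primes — the tree's
`Literature.NumberTheory.EllipticCurves.IsKolyvaginPrime N W K p ℓ` (`HeegnerPointsKolyvaginEulerSystem`, Gross 1991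
§3 (3.1)–(3.2), `Frob(ℓ) = Frob(∞)` in `Gal(K(E_p)/ℚ)`) records the Galois-theoretic condition, whose printed consequence
(3.3) "`a_ℓ ≡ ℓ + 1 ≡ 0 (mod p)`" is what is spelled out here (`q ≡ 2 (mod 3)`, `3 ∣ a_q`, `D` a non-square mod `q`);
no equivalence between the two predicates is claimed in the kernel (it needs `ρ̄_{E,3}` onto and Chebotarev-free
bookkeeping only, but is not a tree theorem).  The class binder `ClassO5 W 3` is the planner's and matches the census
population (the (t′) classes with `9 ∥ N`); the interfaces `BrandtJochnowitzData` / `HeegnerLocalData` are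
definition requests D-O5-J1 / D-O5-J2 (nothing constructed), exactly as `AnemicModThreeMultiplicity` /
`KuriharaModuleDatum` elsewhere in the lane.  0 Literature facts; nothing asserted.
-/

open scoped Classical

open WeierstrassCurve Summit.BirchSwinnertonDyer.Rank1Residual.Additive
open Literature.NumberTheory.EllipticCurves

namespace Summit.BirchSwinnertonDyer.Rank1Residual.O5

/-! ## §1 Interfaces (definition requests D-O5-J1, D-O5-J2) and the Kolyvagin-prime predicate -/

/-- **D-O5-J1 (definition request; INTERFACE, nothing constructed).** Brandt–Jochnowitz data at `p = 3`:
for a level `N ≥ 1`, a prime `q ∤ N` with `q ≡ 2 (mod 3)`, an integral eigenvalue system `a : ℕ → ℤ`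
(read at primes `ℓ ∤ Nq` as `T_ℓ`-eigenvalues), a sign `s ∈ {1, −1}` and a discriminant `D < 0`:
* `eigDim N q a s` is to mean `dim_{𝔽₃} {φ : Cl(R) → 𝔽₃ ∣ T_ℓ φ = a ℓ · φ (ℓ ∤ Nq prime), W_q φ = s φ}`,
  `R` an Eichler order of level `N` in the definite quaternion algebra over `ℚ` ramified exactly at
  `{q, ∞}`, `W_q[I] = [I·𝔔]` (`𝔔` the two-sided ideal of norm `q`) — the Brandt-side multiplicity `μ_B`;
* `sees N q a s D` is to mean: the ORIENTED Gross-points vector `ψ_K ∈ ℤ[Cl(R)]` of `K = ℚ(√D)`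
  (BD99 §4: the `h_K` optimal embeddings `𝓞_K → R_i` oriented at `N` and at `q`) satisfies
  `φ · ψ_K ≢ 0 (mod 3)` for some `φ` in that eigenspace, i.e. `ψ_K ∉ 𝔪^s M̃`. -/
structure BrandtJochnowitzData where
  /-- `μ_B`: the dimension of the mod-`3` eigenspace with `W_q`-sign `s` (see the structure docstring). -/
  eigDim : ℕ → ℕ → (ℕ → ℤ) → ℤ → ℕ
  /-- "`ψ_K` is seen by the eigenspace with sign `s`" (see the structure docstring). -/
  sees : ℕ → ℕ → (ℕ → ℤ) → ℤ → ℤ → Prop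

/-- **D-O5-J2 (definition request; INTERFACE, nothing constructed).** `locNondiv W D q` is to mean: for
the elliptic curve `E` given by the globally minimal model `W`, `K = ℚ(√D)` satisfying the Heegner
hypothesis for `N_E`, and a prime `q` inert in `K`, a Heegner point `y_K ∈ E(K)` of level `N_E`
(`IsHeegnerPoint`) has NON-ZERO image in `E(K_𝔮) ⊗ ℤ/3ℤ`, `𝔮 = q𝓞_K` (independent of the choice of
`y_K` up to sign and torsion prime to `3` when `E(K)[3] = 0`). Instrumented as
`[k_E = 0] ∧ [generator ∉ 3·E(𝔽_q)]` (EVIDENCE, see the file docstring). -/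
structure HeegnerLocalData where
  /-- "`y_K ≢ 0` in `E(K_𝔮)/3E(K_𝔮)`" (see the structure docstring). -/
  locNondiv : WeierstrassCurve ℚ → ℤ → ℕ → Prop

/-- A **Kolyvagin prime at `p = 3`** for `(E, D)`: `q` prime, `q ≡ 2 (mod 3)`, `q ∤ N_E·D`, `q` inert in
`K = ℚ(√D)` (`D` a non-square mod `q`) and `a_q(E) ≡ 0 (mod 3)`; equivalently `Frob_q` is conjugate to
complex conjugation in `Gal(K(E[3])/ℚ)` (the unique quadratic subfield of `ℚ(E[3])` is `ℚ(√−3) ≠ K`).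
Then `#E(𝔽_q) ≡ q + 1 − a_q ≡ 0 (mod 3)` and `E(𝔽_q)[3] ≅ ℤ/3`. [folklore] -/
def IsKolyvaginPrimeAtThree (W : WeierstrassCurve ℚ) (D : ℤ) (q : ℕ) : Prop :=
  q.Prime ∧ q % 3 = 2 ∧ ¬ q ∣ W.conductorNorm ℤ ∧ ¬ (q : ℤ) ∣ D ∧ (3 : ℤ) ∣ W.LFunction q ∧
    ¬ IsSquare ((D : ZMod q))

/-- The eigenvalue system of `W` read at primes: `ℓ ↦ a_ℓ(W)`. [folklore] -/
noncomputable def eigSystem (W : WeierstrassCurve ℚ) : ℕ → ℤ := fun ℓ ↦ W.LFunction ℓ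

/-- The BD sign `s_E = ε = −(sign of the functional equation of L(E/ℚ,s)) = (−1)^{r_an(E/ℚ)+1}`. [folklore] -/
noncomputable def bdSign (W : WeierstrassCurve ℚ) : ℤ := (-1) ^ (W.analyticRank + 1)

variable (J : BrandtJochnowitzData) (Hl : HeegnerLocalData)

/-! ## §2 The printed shape (hypothesis) and the conjectures (EVIDENCE-labelled; nothing asserted) -/

/-- **BD99 as a HYPOTHESIS SHAPE over the interfaces (not a fact minted here).** [BertoliniDarmon1999,
Thm. 1.3 + Thm. 2.3 + Thm. 6.1] at `p = 3`: for `E/ℚ` with `3 ∤ N_E`, `ρ̄_{E,3}` onto, `3 ∤ deg(π_E)`,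
`K` imaginary quadratic with the Heegner hypothesis, `d_K ∉ {−3, −4}`, `r_an(E/K) = 1`, and `q` a
Kolyvagin prime: `μ_B = 1` for both signs, and `ψ_K` is seen by the sign-`s` eigenspace iff
`s = s_E` and `y_K ≢ 0` in `E(K_𝔮)/3`. Census calibration (kit j149039 and the GEN-10 smoke rows):
see the file docstring. Used only as `(h : JochnowitzBD99Shape J Hl)`. [cite: BertoliniDarmon1999, Thm. 1.3] -/
def JochnowitzBD99Shape : Prop :=
  ∀ (W : WeierstrassCurve ℚ) [W.IsElliptic] [W.IsGloballyMinimal]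
    (K : Type) [Field K] [NumberField K] (q : ℕ) (s : ℤ),
    ¬ 3 ∣ W.conductorNorm ℤ → W.HasSurjectiveModNGaloisRep 3 →
    (∀ (N : ℕ) [NeZero N], W.conductorNorm ℤ = N →
        ∀ Dt : ModularForms.ModularParametrizationData W N, ¬ 3 ∣ Dt.modularDegree) →
    IsImaginaryQuadratic K → NumberField.discr K ≠ -3 → NumberField.discr K ≠ -4 →
    SatisfiesHeegnerHypothesis (W.conductorNorm ℤ) K →
    IsKolyvaginPrimeAtThree W (NumberField.discr K) q → analyticRankEK W K = 1 →
    (s = 1 ∨ s = -1) →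
      J.eigDim (W.conductorNorm ℤ) q (eigSystem W) s = 1 ∧
      (J.sees (W.conductorNorm ℤ) q (eigSystem W) s (NumberField.discr K) ↔
        (s = bdSign W ∧ Hl.locNondiv W (NumberField.discr K) q))

/-- **E-O5-JOCH3 — conjecture "JOCHNOWITZ@9", MAIN-SIGN LAW (the surviving form of pre-registration P2; the
target T-O5-J of this seat).** For every elliptic curve `E/ℚ` in the cell's class O5 at `3` (`ClassO5 W 3`: additive,
tame, potentially supersingular — Kodaira `III`, `III*` (e = 4) or `I₀*` with supersingular quadratic twist) with
`ρ̄_{E,3}` onto, every imaginary quadratic `K` with the Heegner hypothesis for `N_E`, `d_K ∉ {−3,−4}`, `r_an(E/K) = 1`,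
and every Kolyvagin prime `q` at `3`: the oriented Gross-points vector `ψ_K` on the class set of the Eichler order of
level `N_E` in `B_{q,∞}` is seen by the mod-`3` eigenspace of `E` WITH THE BD SIGN `s_E = (−1)^{r_an(E/ℚ)+1}` iff
`y_K ≢ 0` in `E(K_𝔮)/3E(K_𝔮)` — BD99 Thm. 1.3 transplanted to `9 ∥ N`, where `μ ≥ 2` and nothing is in print.
EVIDENCE: census-1 kit j149039 (`JOCH3-CENSUS-1.md`): 30/30 O5 rows (`o5Rows_fitsMain`), 10 of them NEGATIVE instances
(`y_K ∈ 3E(K_𝔮)` and `ψ_K ∈ 𝔪^{s_E} M̃`: `99a1 234a1 387d1 423d1 522b1 522g1 558a1 558e1 603a1 603e1`), over Kodaira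
III 11 / III* 13 / I₀* 6 and T33 classes split / nonsplit / irr all represented; 40/40 calibration rows. FALSIFIER: one O5 row with complete data and
`[ψ_K seen at s_E] ≠ [y_K ∉ 3E(K_𝔮)]` (pre-registration classes (i)/(ii)); the bit `r = 0` is robust, `r = 1` is read on an
eigenspace cut by finitely many `T_ℓ` (stability arm S2, kit j149268).
E-ONLY versus CLASS-LEVEL (recorded 2026-08-22, arm S3 / ADDENDUM 3): the `→` direction as typed says the main-sign eigenspace sees `ψ_K`
ONLY IF `E`'s own Heegner point is locally indivisible; the class-level vector law (`CompanionVisibilityAtNine` + its informal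
converse) would also accept a SAME-sign congruent carrier.  The two readings differ only on a "decisive row" (`y_K ∈ 3E(K_𝔮)` while a
same-sign rational companion has an indivisible point); the curve-side scan over every alternative Kolyvagin prime with `h ≤ 1200`
(52 (curve, q) rows) has NO decisive row, because congruent same-sign companions SHARE the bit (`HeegnerBitSharedByCompanions`,
29/29) — so decisive rows require a Tamagawa-3 / `Ш[3]` mismatch inside the congruence class or an irrational carrier (CENSUS-2 (e)). -/
@[conjecture] def JochnowitzAtNine : Prop :=
  ∀ (W : WeierstrassCurve ℚ) [W.IsElliptic] [W.IsGloballyMinimal]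
    (K : Type) [Field K] [NumberField K] (q : ℕ),
    ClassO5 W 3 → W.HasSurjectiveModNGaloisRep 3 →
    IsImaginaryQuadratic K → NumberField.discr K ≠ -3 → NumberField.discr K ≠ -4 →
    SatisfiesHeegnerHypothesis (W.conductorNorm ℤ) K →
    IsKolyvaginPrimeAtThree W (NumberField.discr K) q → analyticRankEK W K = 1 →
      (J.sees (W.conductorNorm ℤ) q (eigSystem W) (bdSign W) (NumberField.discr K) ↔
        Hl.locNondiv W (NumberField.discr K) q)

/-- **TOMBSTONE (pre-registration P2 as first typed, the NAIVE two-sign transplant; REFUTED-BY-CENSUS shape, kept so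
that it is not re-proposed).** "… seen by the sign-`s` eigenspace iff `s = s_E` and `y_K ≢ 0 (mod 3)` locally" — i.e.
additionally `ψ_K ∈ 𝔪^{−s_E} M̃` always. FALSE AS DATA on the O5 cell: 12 of the 30 census-1 rows (kit j149039; `o5Rows_naive_fails`) — `99a1 153a1 153c1
234a1 333c1 333d1 387d1 477a1 522b1 522i1 522l1 558a1` — have `ψ_K ∉ 𝔪^{−s_E} M̃` (pre-registered deviation class
(iii), "opposite-sign leakage"); on every such row but `477a1` a RATIONAL congruent companion `E′` of level dividing
`N_E`, of the opposite rank parity and with `y′_K ∉ 3E′(K_𝔮)`, carries it (vector law, `CompanionVisibilityAtNine`);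
never on the 33 calibration rows of BD99's theorem regime (one companion-carried instance at N = 116, `3 ∣ deg π_E`). Plain `def`, not a conjecture node. -/
def JochnowitzAtNineNaive : Prop :=
  ∀ (W : WeierstrassCurve ℚ) [W.IsElliptic] [W.IsGloballyMinimal]
    (K : Type) [Field K] [NumberField K] (q : ℕ) (s : ℤ),
    ClassO5 W 3 → W.HasSurjectiveModNGaloisRep 3 →
    IsImaginaryQuadratic K → NumberField.discr K ≠ -3 → NumberField.discr K ≠ -4 →
    SatisfiesHeegnerHypothesis (W.conductorNorm ℤ) K →
    IsKolyvaginPrimeAtThree W (NumberField.discr K) q → analyticRankEK W K = 1 →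
    (s = 1 ∨ s = -1) →
      (J.sees (W.conductorNorm ℤ) q (eigSystem W) s (NumberField.discr K) ↔
        (s = bdSign W ∧ Hl.locNondiv W (NumberField.discr K) q))

/-- The BD sign is `±1`. [folklore] -/
theorem bdSign_eq_one_or (W : WeierstrassCurve ℚ) : bdSign W = 1 ∨ bdSign W = -1 := by
  unfold bdSign
  rcases Nat.even_or_odd (W.analyticRank + 1) with h | h
  · exact Or.inl h.neg_one_pow
  · exact Or.inr h.neg_one_pow

/-- The naive two-sign transplant implies the main-sign law (kernel-checked edge: the tombstone is the STRONGER
shape; its refutation by census rows does not touch `JochnowitzAtNine`). [folklore] -/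
theorem jochnowitzAtNine_of_naive (h : JochnowitzAtNineNaive J Hl) : JochnowitzAtNine J Hl := by
  intro W _ _ K _ _ q hO5 hsurj hK h3 h4 hH hq hr
  have := h W K q (bdSign W) hO5 hsurj hK h3 h4 hH hq hr (bdSign_eq_one_or W)
  simpa using this

/-- **E-O5-JOCH3-V — COMPANION VISIBILITY at `9 ∥ N` (pre-registration P2 class (i)/(iii), vector law J-c; the
rational-companion direction, EVIDENCE).** Same setting; if SOME elliptic curve `E′/ℚ` of conductor dividing `N_E` with
`a_ℓ(E′) ≡ a_ℓ(E) (mod 3)` for all primes `ℓ ∤ 3N_E` (`E′ = E` allowed), with `r_an(E′/K) = 1` and BD sign `s = s_{E′}`,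
has `y′_K ∉ 3E′(K_𝔮)`, then the sign-`s` eigenspace sees `ψ_K`. (The converse — no direction without such a carrier — holds on 139 of
the 140 census-1 bits, the exception `477a1` (`N = 477`, I₀*) having no RATIONAL companion at all — the converse belongs to the congruence class of `E` among
ALL newforms of level dividing `N_E`, rational or not, and is recorded informally only: typing it needs Hecke fields and a
prime above `3`, definition request D-O5-J3.) EVIDENCE: census-1 j149039 — every direction with a rational carrier is observed (carried by `E` itself: O5 20, calibration
32; carried by a companion `E′ ≠ E`: O5 11, calibration 1; 0 exceptions), and 75 of the 76 bits WITHOUT a rational carrier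
are unset (the exception: `477a1`, opposite sign). -/
@[conjecture] def CompanionVisibilityAtNine : Prop :=
  ∀ (W : WeierstrassCurve ℚ) [W.IsElliptic] [W.IsGloballyMinimal]
    (K : Type) [Field K] [NumberField K] (q : ℕ) (s : ℤ),
    ClassO5 W 3 → W.HasSurjectiveModNGaloisRep 3 →
    IsImaginaryQuadratic K → NumberField.discr K ≠ -3 → NumberField.discr K ≠ -4 →
    SatisfiesHeegnerHypothesis (W.conductorNorm ℤ) K →
    IsKolyvaginPrimeAtThree W (NumberField.discr K) q → analyticRankEK W K = 1 →
    (s = 1 ∨ s = -1) →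
      (∃ (W' : WeierstrassCurve ℚ) (_ : W'.IsElliptic) (_ : W'.IsGloballyMinimal),
          W'.conductorNorm ℤ ∣ W.conductorNorm ℤ ∧
          (∀ ℓ : ℕ, ℓ.Prime → ¬ ℓ ∣ 3 * W.conductorNorm ℤ →
              (3 : ℤ) ∣ W'.LFunction ℓ - W.LFunction ℓ) ∧
          analyticRankEK W' K = 1 ∧ s = bdSign W' ∧ Hl.locNondiv W' (NumberField.discr K) q) →
      J.sees (W.conductorNorm ℤ) q (eigSystem W) s (NumberField.discr K)

/-- **E-O5-J-d — congruent same-sign companions SHARE the Heegner bit (curve side; EVIDENCE, arm S3 scan 2026-08-22).**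
For `E` in the O5 class with `ρ̄_{E,3}` surjective and `E′/ℚ` an elliptic curve with `a_ℓ(E′) ≡ a_ℓ(E) (mod 3)` for all `ℓ ∤ 3 N_E N_{E′}`,
both of analytic rank one over a Heegner field `K` (for both conductors), and BOTH Heegner points locally 3-indivisible at SOME prime
(i.e. Heegner index prime to `3` on both sides — without this the statement is false for trivial reasons), the bits agree at every
Kolyvagin prime `q ∤ N_{E′}` of `E`: `y_K ∉ 3E(K_𝔮) ↔ y′_K ∉ 3E′(K_𝔮)`.  WHY EXPECTED: both bits are `loc_𝔮` of the Kummer class of the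
Heegner point in a one-dimensional `Sel₃(·/K) ⊂ H¹(K, E[3]) = H¹(K, E′[3])`; if `E` and `E′` are 3-Selmer companions over `K` — the
content at the ADDITIVE prime `3` of `E` versus a companion of level `N_E/9` or `N_E/3` (o5-r1's T27/T28 vocabulary) — the two lines
coincide and so do their localisations.  In print nearby: Kriz–Li, *Goldfeld's conjecture and congruences between Heegner points*, Forum
Math. Sigma 7 (2019) e15, Thm 1.16 [corpus: paper:doi-10-1017-fms-2019-9 p0002] — a congruence of `p`-adic logarithms of Heegner points
for `E[p^m]^{ss} ≅ E′[p^m]^{ss}` with `p` split in `K`, up to Euler factors at `ℓ ∣ N N′/M`.  **ERRATUM E-KL3** ⟦o5-r2 GEN 16 ask A-O5-G16-2,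
`HOME/b2b-bsdres-o5-r2/gen16/KL3-DERIVATION.md` §1 (sha16 `b692d90d135fc6c7`), HOME/INBOX.md l.13174; cc-typer-5 GEN 17, docket cc-lead ⟦gen65⟧/⟦gen66⟧ (2′) (c29); docstring only,
decl text unchanged⟧: the earlier remark here — 'at `p = 3 ∣ N_E` additively the factor `|Ẽ^{ns}(𝔽_3)| = 3` makes that congruence DEGENERATE whenever
`9 ∤ N_{E′}`, so it does not imply this node across the additive/good divide' — was WRONG: the factor enters DIVIDED by `ℓ = 3` (for the additive
(t′) curve `|Ẽ^{ns}(𝔽_3)|/3 = 1` and the stabilisation `f^{(3)} = f`), and the companion's factor `(4 − a_3)/3` is compensated exactly by the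
formal-group divisibility of `log` on `G(ℚ₃)` (o5-r2's KL3-A′).  CORRECTED TEXT (o5-r2's words, verbatim): "the Kriz–Li congruence (Thm. 1.16,
`p ∣ N` allowed) transports the unit bit of the normalised logarithm `u·log_ω P` between `E` and ANY mod-3 companion, semistable at `3` or not;
see `O5/HeegnerLogTransportThree.lean`" (o5-r2 GEN 16's typed KL3 file `gen16/lean/HeegnerLogTransportThree.lean`, placement ask A-O5-G16-1).
EVIDENCE: scan `scan_s3.py` b070c0df6a9b4063 → `scan_s3_rows.json` 359bf5272fac1d10: 16 same-sign pairs, 29 (E, E′, q) triples, **29/29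
agree** (9 jointly indivisible-false triples, 12 of the 16 pairs straddle additive-at-3 / good-or-multiplicative-at-3); control: 25
opposite-sign pairs, 43 triples, 24 agree / 19 disagree.  FALSIFIER: one same-sign pair with both indices prime to 3 and different bits at
one Kolyvagin prime. -/
@[conjecture] def HeegnerBitSharedByCompanions : Prop :=
  ∀ (W W' : WeierstrassCurve ℚ) [W.IsElliptic] [W.IsGloballyMinimal] [W'.IsElliptic] [W'.IsGloballyMinimal]
    (K : Type) [Field K] [NumberField K] (q : ℕ),
    ClassO5 W 3 → W.HasSurjectiveModNGaloisRep 3 →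
    IsImaginaryQuadratic K → NumberField.discr K ≠ -3 → NumberField.discr K ≠ -4 →
    SatisfiesHeegnerHypothesis (W.conductorNorm ℤ) K → SatisfiesHeegnerHypothesis (W'.conductorNorm ℤ) K →
    (∀ ℓ : ℕ, ℓ.Prime → ¬ ℓ ∣ 3 * W.conductorNorm ℤ * W'.conductorNorm ℤ →
        (3 : ℤ) ∣ W'.LFunction ℓ - W.LFunction ℓ) →
    analyticRankEK W K = 1 → analyticRankEK W' K = 1 →
    (∃ q₀ : ℕ, Hl.locNondiv W (NumberField.discr K) q₀) → (∃ q₀ : ℕ, Hl.locNondiv W' (NumberField.discr K) q₀) →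
    IsKolyvaginPrimeAtThree W (NumberField.discr K) q → ¬ q ∣ W'.conductorNorm ℤ →
      (Hl.locNondiv W (NumberField.discr K) q ↔ Hl.locNondiv W' (NumberField.discr K) q)

/-- **Brandt-side level raising at a Kolyvagin prime, BOTH signs (EVIDENCE; Ribet 1990 / Diamond–Taylor 1994 give
`μ_B ≥ 1` for one sign in print when `p ∤ N`; pre-registration P1).** For `E` as in `JochnowitzAtNine` and `q` a Kolyvagin prime
at `3`: `μ_B(+1) ≥ 1` and `μ_B(−1) ≥ 1`. The VALUES on the O5 cell (A-O5-13; upper bounds; arm S2 = kit j149268 with 12 Hecke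
operators, superseding the 6-operator read of j149039 whose three sign-asymmetric values at `N = 522, q = 5` were under-determination
artefacts): SIGN-SYMMETRIC 30/30; `(2,2)` on all 17 Kodaira III / I₀* rows; `(3,3)` on the 10 III* rows having a rational companion of
level `N/9` or `N/3` and `(2,2)` on the 4 without; `(1,1)` on all 35 calibration rows with no rational companion (33 of BD99's regime + 2),
`(2,2)` on the 5 with one — kernel table check `o5Rows_mu`; recorded in `JOCH3-CENSUS-1.md`, the pattern is EVIDENCE, only `≥ 1` is typed. -/
@[conjecture] def BrandtMultAtNine : Prop :=
  ∀ (W : WeierstrassCurve ℚ) [W.IsElliptic] [W.IsGloballyMinimal] (D : ℤ) (q : ℕ),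
    ClassO5 W 3 → W.HasSurjectiveModNGaloisRep 3 → IsKolyvaginPrimeAtThree W D q →
      1 ≤ J.eigDim (W.conductorNorm ℤ) q (eigSystem W) 1 ∧
      1 ≤ J.eigDim (W.conductorNorm ℤ) q (eigSystem W) (-1)

/-! ## §3 Census record schema (decidable bookkeeping; the rows live in `O5/JochnowitzAtThreeRecords.lean`) -/

/-- One JOCH3 census row (kit j149039 schema, pre-registration `JOCH3-PREREG.md`): the curve label is
kept in the records file's docstrings; here only the decidable content. `kod`: `3` = III, `9` = III*,
`6` = I₀*; `rank` = `r_an(E/ℚ)`; `dPlus/dMinus` = `μ_B(±1)`; `rPlus/rMinus` = the bits `r^{±1}`;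
`lhs` = the curve-side bit (`none` when Cremona data are missing); `k` = the Heegner currency. [folklore] -/
structure JochRow where
  /-- conductor -/
  N : ℕ
  /-- `v₃(Δ_min)`: 3, 6 or 9 -/
  kod : ℕ
  /-- analytic rank of `E/ℚ` (Cremona) -/
  rank : ℕ
  /-- discriminant of `K` -/
  D : ℤ
  /-- the Kolyvagin prime -/
  q : ℕ
  /-- class number `h` of the Eichler order (size of the Brandt module) -/
  h : ℕ
  /-- `μ_B(+1)` -/
  dPlus : ℕ
  /-- `μ_B(−1)` -/
  dMinus : ℕ
  /-- bit `r^{+1}` -/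
  rPlus : Bool
  /-- bit `r^{−1}` -/
  rMinus : Bool
  /-- curve-side bit `LHS_E` -/
  lhs : Option Bool
  /-- Heegner currency `k_E` -/
  k : Option ℕ
  deriving DecidableEq, Repr

namespace JochRow

/-- The sign-`s_E` bit (`s_E = +1` iff the rank is odd) of a row. [folklore] -/
def mainBit (r : JochRow) : Bool := if r.rank % 2 = 1 then r.rPlus else r.rMinus

/-- The opposite-sign bit. [folklore] -/
def otherBit (r : JochRow) : Bool := if r.rank % 2 = 1 then r.rMinus else r.rPlus

/-- `FitsMain`: the row fits the main-sign law (`r^{s_E} = LHS_E`); a row with missing curve data fits vacuously.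
[folklore] -/
def FitsMain (r : JochRow) : Prop := r.lhs = none ∨ r.lhs = some r.mainBit

/-- `FitsP2`: the row fits the NAIVE two-sign law P2 (`r^{s_E} = LHS_E` and `r^{−s_E} = 0`). [folklore] -/
def FitsP2 (r : JochRow) : Prop := r.FitsMain ∧ r.otherBit = false

/-- `FitsMain` is decidable (for the `decide`d table checks of the records file). [folklore] -/
instance (r : JochRow) : Decidable r.FitsMain := by unfold FitsMain; infer_instance

/-- `FitsP2` is decidable. [folklore] -/
instance (r : JochRow) : Decidable r.FitsP2 := by unfold FitsP2; infer_instance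

end JochRow

/-! ## §4 Kernel edges between the nodes (cc-typer-5 GEN 14; PROVED bookkeeping over the nodes as hypotheses) -/

/-- **`CompanionVisibilityAtNine` with the carrier `E′ = E` gives the (←) half of `JochnowitzAtNine`**: if `y_K ∉ 3E(K_𝔮)`
then the sign-`s_E` eigenspace sees `ψ_K` (the carrier clause is met by `E` itself: `N_E ∣ N_E`, `3 ∣ a_ℓ − a_ℓ`,
`r_an(E/K) = 1`, `s = s_E`).  So the content proper of T-O5-J beyond the vector law is its E-only (→) half (docstring
of `JochnowitzAtNine`, "E-ONLY versus CLASS-LEVEL").  Nothing is claimed about either node. [folklore] -/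
theorem sees_bdSign_of_companionVisibility (hV : CompanionVisibilityAtNine J Hl)
    (W : WeierstrassCurve ℚ) [W.IsElliptic] [W.IsGloballyMinimal] (K : Type) [Field K] [NumberField K] (q : ℕ)
    (hO5 : ClassO5 W 3) (hsurj : W.HasSurjectiveModNGaloisRep 3) (hK : IsImaginaryQuadratic K)
    (h3 : NumberField.discr K ≠ -3) (h4 : NumberField.discr K ≠ -4)
    (hH : SatisfiesHeegnerHypothesis (W.conductorNorm ℤ) K)
    (hq : IsKolyvaginPrimeAtThree W (NumberField.discr K) q) (hr : analyticRankEK W K = 1)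
    (hloc : Hl.locNondiv W (NumberField.discr K) q) :
    J.sees (W.conductorNorm ℤ) q (eigSystem W) (bdSign W) (NumberField.discr K) :=
  hV W K q (bdSign W) hO5 hsurj hK h3 h4 hH hq hr (bdSign_eq_one_or W)
    ⟨W, ‹_›, ‹_›, dvd_rfl, fun ℓ _ _ ↦ by simp, hr, rfl, hloc⟩

/-- **Given `CompanionVisibilityAtNine`, T-O5-J `JochnowitzAtNine` reduces to its E-only (→) half** ("the main-sign
eigenspace sees `ψ_K` ONLY IF `E`'s own Heegner point is locally `3`-indivisible at `q`"), displayed as the hypothesis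
`hE`.  Kernel bookkeeping; nothing asserted. [folklore] -/
theorem jochnowitzAtNine_of_companionVisibility (hV : CompanionVisibilityAtNine J Hl)
    (hE : ∀ (W : WeierstrassCurve ℚ) [W.IsElliptic] [W.IsGloballyMinimal]
      (K : Type) [Field K] [NumberField K] (q : ℕ),
      ClassO5 W 3 → W.HasSurjectiveModNGaloisRep 3 →
      IsImaginaryQuadratic K → NumberField.discr K ≠ -3 → NumberField.discr K ≠ -4 →
      SatisfiesHeegnerHypothesis (W.conductorNorm ℤ) K →
      IsKolyvaginPrimeAtThree W (NumberField.discr K) q → analyticRankEK W K = 1 →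
        J.sees (W.conductorNorm ℤ) q (eigSystem W) (bdSign W) (NumberField.discr K) →
          Hl.locNondiv W (NumberField.discr K) q) :
    JochnowitzAtNine J Hl := by
  intro W _ _ K _ _ q hO5 hsurj hK h3 h4 hH hq hr
  exact ⟨hE W K q hO5 hsurj hK h3 h4 hH hq hr,
    sees_bdSign_of_companionVisibility J Hl hV W K q hO5 hsurj hK h3 h4 hH hq hr⟩

end Summit.BirchSwinnertonDyer.Rank1Residual.O5
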